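import Summits.CriticalPhenomena.SAWScalingLimit.Theses.SAWDefectDecoherence
import Literature.Probability.RandomPlanarGeometry.SimpleCurves
import Mathlib.MeasureTheory.Measure.Portmanteau
import HarnessLib

/-!
# Crux `SAWDefectDecoherence.ObservableToSLER` (stmt-CriticalPhenomena-14005), line
`bridge-gate-renewal` (r7), stub 5a3 `stub_twoPieceAdmIdentification`: the Duminil-Copin–Smirnov
law on mid-edge walks as a measure on curve classes, and what its weak limits inherit

Landing target:
`Summits/CriticalPhenomena/SAWScalingLimit/Theorems/SAWDefectDecoherenceObservableToSLERTwoPieceAdmIdentificationLaw.lean`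
(`--supports stmt-CriticalPhenomena-14005`).

Stub 5a3 types the critical law `P_Λ(γ) ∝ x_c^{ℓ(γ)}` on the mid-edge self-avoiding walks
`HexMidEdgeSAW Λ a b` MEASURE-FREE, as ratios of finite sums, and its weak convergence along meshes
`s n → 0⁺` to a probability law `μ` as convergence of the ratios
`(Σ_γ x_c^{ℓ(γ)} f(curve γ)) / (Σ_γ x_c^{ℓ(γ)})` for bounded continuous `f`.  This file builds the
bridge to measure theory:

* the normalised push-forward `Σ_γ (x_c^{ℓ(γ)}/Z) δ_{curve γ}` as a `Measure` (file-local
  notation `(∑ γ : HexMidEdgeSAW Λ a b, ENNReal.ofReal (hexCriticalFugacity ^ γ.length /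
        (∑ γ' : HexMidEdgeSAW Λ a b, hexCriticalFugacity ^ γ'.length)) •
        Measure.dirac (CurveClass.mk ⟨polyline (γ.verts.map fun v => ((δ : ℝ) : ℂ) *
          hexCenter v)⟩) : Measure (CurveClass ℂ))`, no new definition), with its values on Borel sets
  (`dcsLaw_apply`), its integrals (`integral_dcsLaw`) and honesty;
* `portmanteau_of_ratio` — ratio convergence = weak convergence of probability measures, whence
  the two portmanteau inequalities along the sequence (Mathlib);
* the transfers used by the identification: `le_measure_of_isClosed_of_ratio` (closed events,
  lower bounds pass to the limit), `measure_le_of_isOpen_of_ratio` (open events, upper bounds),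
  `ae_mem_of_isClosed_of_ratio` (sure closed events).

The sequel `…TwoPieceAdmIdentificationLimits` derives endpoints, confinement and simplicity of the
limit classes.
-/

noncomputable section

open scoped BigOperators Topology NNReal ENNReal BoundedContinuousFunction Classical
open Filter Set MeasureTheory Metric
open Literature.Probability.LatticeModels (HexVertex hexGraph hexCenter polyline)
open Literature.Probability.RandomPlanarGeometry
open Literature.Probability.RandomPlanarGeometry.SAW

namespace Summit.CriticalPhenomena.SAWScalingLimit.Theorems.ObservableToSLER.TwoPiece

/-! ### The DCS law on mid-edge walks as a measure on curve classes -/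

section Law

variable (Λ : Finset HexVertex) (δ : ℝ) (a b : Sym2 HexVertex)

variable {Λ δ a b}

/-- The critical mass is nonnegative. [folklore] -/
theorem dcsMass_nonneg : 0 ≤ ∑ γ : HexMidEdgeSAW Λ a b, hexCriticalFugacity ^ γ.length :=
  Finset.sum_nonneg fun _ _ => pow_nonneg hexCriticalFugacity_pos_lt_one.1.le _

/-- The critical mass is positive as soon as there is a walk. [folklore] -/
theorem dcsMass_pos (h : Nonempty (HexMidEdgeSAW Λ a b)) :
    0 < ∑ γ : HexMidEdgeSAW Λ a b, hexCriticalFugacity ^ γ.length := by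
  obtain ⟨γ⟩ := h
  exact lt_of_lt_of_le (pow_pos hexCriticalFugacity_pos_lt_one.1 γ.length)
    (Finset.single_le_sum (f := fun γ : HexMidEdgeSAW Λ a b => hexCriticalFugacity ^ γ.length)
      (fun γ _ => pow_nonneg hexCriticalFugacity_pos_lt_one.1.le _) (Finset.mem_univ γ))

/-- **Values of the DCS law**: `P(E) = (Σ_{γ : curve γ ∈ E} x_c^{ℓ(γ)}) / Z`. [folklore] -/
theorem dcsLaw_apply {E : Set (CurveClass ℂ)} (hE : MeasurableSet E) :
    (∑ γ : HexMidEdgeSAW Λ a b, ENNReal.ofReal (hexCriticalFugacity ^ γ.length /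
        (∑ γ' : HexMidEdgeSAW Λ a b, hexCriticalFugacity ^ γ'.length)) •
        Measure.dirac (CurveClass.mk ⟨polyline (γ.verts.map fun v => ((δ : ℝ) : ℂ) *
          hexCenter v)⟩) : Measure (CurveClass ℂ)) E = ENNReal.ofReal
      ((∑ γ : HexMidEdgeSAW Λ a b,
        if CurveClass.mk ⟨polyline (List.map (fun v => ((δ : ℝ) : ℂ) * hexCenter v) γ.verts)⟩ ∈ E
        then hexCriticalFugacity ^ γ.length else 0) /
          ∑ γ : HexMidEdgeSAW Λ a b, hexCriticalFugacity ^ γ.length) := by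
  classical
  rw [Measure.finsetSum_apply, Finset.sum_div,
    ENNReal.ofReal_sum_of_nonneg fun γ _ => ?_]
  · refine Finset.sum_congr rfl fun γ _ => ?_
    rw [Measure.smul_apply, Measure.dirac_apply' _ hE, smul_eq_mul]
    by_cases h : CurveClass.mk ⟨polyline (List.map (fun v => ((δ : ℝ) : ℂ) * hexCenter v)
        γ.verts)⟩ ∈ E
    · rw [indicator_of_mem h, Pi.one_apply, mul_one, if_pos h]
    · rw [indicator_of_notMem h, mul_zero, if_neg h, zero_div, ENNReal.ofReal_zero]
  · split_ifs
    · exact div_nonneg (pow_nonneg hexCriticalFugacity_pos_lt_one.1.le _) dcsMass_nonneg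
    · rw [zero_div]

/-- **Honesty**: with at least one walk the DCS law is a probability measure. [folklore] -/
theorem isProbabilityMeasure_dcsLaw (h : Nonempty (HexMidEdgeSAW Λ a b)) :
    IsProbabilityMeasure (∑ γ : HexMidEdgeSAW Λ a b, ENNReal.ofReal (hexCriticalFugacity ^ γ.length /
        (∑ γ' : HexMidEdgeSAW Λ a b, hexCriticalFugacity ^ γ'.length)) •
        Measure.dirac (CurveClass.mk ⟨polyline (γ.verts.map fun v => ((δ : ℝ) : ℂ) *
          hexCenter v)⟩) : Measure (CurveClass ℂ)) := by
  refine ⟨?_⟩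
  rw [dcsLaw_apply MeasurableSet.univ]
  simp only [mem_univ, if_true]
  rw [div_self (dcsMass_pos h).ne', ENNReal.ofReal_one]

/-- **Integrals against the DCS law**: `∫ f dP = (Σ_γ x_c^{ℓ(γ)} f(curve γ)) / Z`. [folklore] -/
theorem integral_dcsLaw (h : Nonempty (HexMidEdgeSAW Λ a b)) (f : CurveClass ℂ →ᵇ ℝ) :
    ∫ x, f x ∂(∑ γ : HexMidEdgeSAW Λ a b, ENNReal.ofReal (hexCriticalFugacity ^ γ.length /
        (∑ γ' : HexMidEdgeSAW Λ a b, hexCriticalFugacity ^ γ'.length)) •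
        Measure.dirac (CurveClass.mk ⟨polyline (γ.verts.map fun v => ((δ : ℝ) : ℂ) *
          hexCenter v)⟩) : Measure (CurveClass ℂ)) =
      (∑ γ : HexMidEdgeSAW Λ a b, hexCriticalFugacity ^ γ.length *
        f (CurveClass.mk ⟨polyline (List.map (fun v => ((δ : ℝ) : ℂ) * hexCenter v) γ.verts)⟩)) /
        ∑ γ : HexMidEdgeSAW Λ a b, hexCriticalFugacity ^ γ.length := by
  classical
  have hZ := dcsMass_pos (Λ := Λ) (a := a) (b := b) h
  rw [integral_finsetSum_measure fun γ _ => ?_]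
  · rw [Finset.sum_div]
    refine Finset.sum_congr rfl fun γ _ => ?_
    rw [integral_smul_measure, integral_dirac, ENNReal.toReal_ofReal
      (div_nonneg (pow_nonneg hexCriticalFugacity_pos_lt_one.1.le _) hZ.le), smul_eq_mul]
    ring
  · exact (f.integrable _).smul_measure ENNReal.ofReal_ne_top

end Law

/-! ### Ratio convergence is weak convergence: portmanteau along the sequence -/

section Portmanteau

variable {Λ : ℝ → Finset HexVertex} {a b : ℝ → Sym2 HexVertex} {s : ℕ → ℝ}
  {μ : Measure (CurveClass ℂ)}

/-- **Portmanteau for ratio limits.**  If along the meshes `s n` there are eventually walks and the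
ratios `(Σ_γ x_c^{ℓ(γ)} f(curve γ)) / Z` converge to `∫ f dμ` for every bounded continuous `f`
(`μ` a probability measure), then for every closed `F`, `limsup P_n(F) ≤ μ F`, and for every open
`G`, `μ G ≤ liminf P_n(G)`, `P_n` the DCS law at mesh `s n`.
[cite: BillingsleyCPM1999, Thm. 2.1 (portmanteau)] -/
theorem portmanteau_of_ratio [IsProbabilityMeasure μ]
    (hne : ∀ᶠ n in atTop, Nonempty (HexMidEdgeSAW (Λ (s n)) (a (s n)) (b (s n))))
    (hconv : ∀ f : CurveClass ℂ →ᵇ ℝ,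
      Tendsto (fun n =>
        (∑ γ : HexMidEdgeSAW (Λ (s n)) (a (s n)) (b (s n)),
            hexCriticalFugacity ^ γ.length *
              f (CurveClass.mk ⟨polyline (γ.verts.map fun v => ((s n : ℝ) : ℂ) * hexCenter v)⟩)) /
          (∑ γ : HexMidEdgeSAW (Λ (s n)) (a (s n)) (b (s n)), hexCriticalFugacity ^ γ.length))
        atTop (𝓝 (∫ x, f x ∂μ))) :
    (∀ F : Set (CurveClass ℂ), IsClosed F →
      limsup (fun n => (∑ γ : HexMidEdgeSAW (Λ (s n)) (a (s n)) (b (s n)), ENNReal.ofReal (hexCriticalFugacity ^ γ.length /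
            (∑ γ' : HexMidEdgeSAW (Λ (s n)) (a (s n)) (b (s n)), hexCriticalFugacity ^ γ'.length)) •
            Measure.dirac (CurveClass.mk ⟨polyline (γ.verts.map fun v => ((s n : ℝ) : ℂ) *
              hexCenter v)⟩) : Measure (CurveClass ℂ)) F) atTop ≤ μ F) ∧
    ∀ G : Set (CurveClass ℂ), IsOpen G →
      μ G ≤ liminf (fun n => (∑ γ : HexMidEdgeSAW (Λ (s n)) (a (s n)) (b (s n)), ENNReal.ofReal (hexCriticalFugacity ^ γ.length /
            (∑ γ' : HexMidEdgeSAW (Λ (s n)) (a (s n)) (b (s n)), hexCriticalFugacity ^ γ'.length)) •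
            Measure.dirac (CurveClass.mk ⟨polyline (γ.verts.map fun v => ((s n : ℝ) : ℂ) *
              hexCenter v)⟩) : Measure (CurveClass ℂ)) G) atTop := by
  classical
  let Q : ℕ → Measure (CurveClass ℂ) := fun n => (∑ γ : HexMidEdgeSAW (Λ (s n)) (a (s n)) (b (s n)), ENNReal.ofReal (hexCriticalFugacity ^ γ.length /
            (∑ γ' : HexMidEdgeSAW (Λ (s n)) (a (s n)) (b (s n)), hexCriticalFugacity ^ γ'.length)) •
            Measure.dirac (CurveClass.mk ⟨polyline (γ.verts.map fun v => ((s n : ℝ) : ℂ) *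
              hexCenter v)⟩) : Measure (CurveClass ℂ))
  let Q' : ℕ → Measure (CurveClass ℂ) := fun n =>
    if IsProbabilityMeasure (Q n) then Q n else μ
  have hQ' : ∀ n, IsProbabilityMeasure (Q' n) := fun n => by
    by_cases h : IsProbabilityMeasure (Q n)
    · simp only [Q', if_pos h]; exact h
    · simp only [Q', if_neg h]; infer_instance
  have hev : ∀ᶠ n in atTop, Q' n = Q n := by
    filter_upwards [hne] with n hn
    have : IsProbabilityMeasure (Q n) := isProbabilityMeasure_dcsLaw hn
    simp only [Q', if_pos this]
  let P : ℕ → ProbabilityMeasure (CurveClass ℂ) := fun n => ⟨Q' n, hQ' n⟩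
  have hP : Tendsto P atTop (𝓝 (⟨μ, inferInstance⟩ : ProbabilityMeasure (CurveClass ℂ))) := by
    rw [ProbabilityMeasure.tendsto_iff_forall_integral_tendsto]
    intro f
    refine (hconv f).congr' ?_
    filter_upwards [hev, hne] with n hn hn'
    change _ = ∫ x, f x ∂Q' n
    rw [hn]
    exact (integral_dcsLaw hn' f).symm
  have hPQ : ∀ᶠ n in atTop, ∀ T : Set (CurveClass ℂ),
      ((P n : ProbabilityMeasure (CurveClass ℂ)) : Measure (CurveClass ℂ)) T = Q n T := by
    filter_upwards [hev] with n hn T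
    change Q' n T = _
    rw [hn]
  refine ⟨fun F hF => ?_, fun G hG => ?_⟩
  · have h := ProbabilityMeasure.limsup_measure_closed_le_of_tendsto hP hF
    refine le_trans (le_of_eq (limsup_congr ?_)) h
    filter_upwards [hPQ] with n hn
    exact (hn F).symm
  · have h := ProbabilityMeasure.le_liminf_measure_open_of_tendsto hP hG
    refine h.trans (le_of_eq (liminf_congr ?_))
    filter_upwards [hPQ] with n hn
    exact hn G

/-- **Closed-set transfer**: an eventual lower bound `q ≤ P_n(F)` for a closed `F` passes to the
limit, `q ≤ μ F` (`P_n(F)` written as the ratio of sums). [cite: BillingsleyCPM1999, Thm. 2.1 (portmanteau, closed sets)] -/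
theorem le_measure_of_isClosed_of_ratio [IsProbabilityMeasure μ]
    (hne : ∀ᶠ n in atTop, Nonempty (HexMidEdgeSAW (Λ (s n)) (a (s n)) (b (s n))))
    (hconv : ∀ f : CurveClass ℂ →ᵇ ℝ,
      Tendsto (fun n =>
        (∑ γ : HexMidEdgeSAW (Λ (s n)) (a (s n)) (b (s n)),
            hexCriticalFugacity ^ γ.length *
              f (CurveClass.mk ⟨polyline (γ.verts.map fun v => ((s n : ℝ) : ℂ) * hexCenter v)⟩)) /
          (∑ γ : HexMidEdgeSAW (Λ (s n)) (a (s n)) (b (s n)), hexCriticalFugacity ^ γ.length))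
        atTop (𝓝 (∫ x, f x ∂μ)))
    {F : Set (CurveClass ℂ)} (hF : IsClosed F) {q : ℝ≥0∞}
    (hq : ∀ᶠ n in atTop, q ≤ ENNReal.ofReal
      ((∑ γ : HexMidEdgeSAW (Λ (s n)) (a (s n)) (b (s n)),
          if CurveClass.mk ⟨polyline (γ.verts.map fun v => ((s n : ℝ) : ℂ) * hexCenter v)⟩ ∈ F
          then hexCriticalFugacity ^ γ.length else 0) /
        ∑ γ : HexMidEdgeSAW (Λ (s n)) (a (s n)) (b (s n)), hexCriticalFugacity ^ γ.length)) :
    q ≤ μ F := by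
  refine le_trans ?_ ((portmanteau_of_ratio hne hconv).1 F hF)
  have hq' : ∀ᶠ n in atTop, q ≤ (∑ γ : HexMidEdgeSAW (Λ (s n)) (a (s n)) (b (s n)), ENNReal.ofReal (hexCriticalFugacity ^ γ.length /
            (∑ γ' : HexMidEdgeSAW (Λ (s n)) (a (s n)) (b (s n)), hexCriticalFugacity ^ γ'.length)) •
            Measure.dirac (CurveClass.mk ⟨polyline (γ.verts.map fun v => ((s n : ℝ) : ℂ) *
              hexCenter v)⟩) : Measure (CurveClass ℂ)) F := by
    filter_upwards [hq] with n hn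
    rwa [dcsLaw_apply hF.measurableSet]
  exact (le_liminf_of_le (by isBoundedDefault) hq').trans (liminf_le_limsup (by isBoundedDefault)
    (by isBoundedDefault))

/-- **Closed-set transfer, limit form**: if `r_n ≤ P_n(F)` eventually for a closed `F` with
`r_n → r₀`, then `r₀ ≤ μ F`. [cite: BillingsleyCPM1999, Thm. 2.1 (portmanteau, closed sets)] -/
theorem le_measure_of_isClosed_of_tendsto [IsProbabilityMeasure μ]
    (hne : ∀ᶠ n in atTop, Nonempty (HexMidEdgeSAW (Λ (s n)) (a (s n)) (b (s n))))
    (hconv : ∀ f : CurveClass ℂ →ᵇ ℝ,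
      Tendsto (fun n =>
        (∑ γ : HexMidEdgeSAW (Λ (s n)) (a (s n)) (b (s n)),
            hexCriticalFugacity ^ γ.length *
              f (CurveClass.mk ⟨polyline (γ.verts.map fun v => ((s n : ℝ) : ℂ) * hexCenter v)⟩)) /
          (∑ γ : HexMidEdgeSAW (Λ (s n)) (a (s n)) (b (s n)), hexCriticalFugacity ^ γ.length))
        atTop (𝓝 (∫ x, f x ∂μ)))
    {F : Set (CurveClass ℂ)} (hF : IsClosed F) {r : ℕ → ℝ≥0∞} {r₀ : ℝ≥0∞}
    (hr : Tendsto r atTop (𝓝 r₀))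
    (hle : ∀ᶠ n in atTop, r n ≤ ENNReal.ofReal
      ((∑ γ : HexMidEdgeSAW (Λ (s n)) (a (s n)) (b (s n)),
          if CurveClass.mk ⟨polyline (γ.verts.map fun v => ((s n : ℝ) : ℂ) * hexCenter v)⟩ ∈ F
          then hexCriticalFugacity ^ γ.length else 0) /
        ∑ γ : HexMidEdgeSAW (Λ (s n)) (a (s n)) (b (s n)), hexCriticalFugacity ^ γ.length)) :
    r₀ ≤ μ F := by
  refine le_trans ?_ ((portmanteau_of_ratio hne hconv).1 F hF)
  have hle' : ∀ᶠ n in atTop, r n ≤ (∑ γ : HexMidEdgeSAW (Λ (s n)) (a (s n)) (b (s n)), ENNReal.ofReal (hexCriticalFugacity ^ γ.length /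
            (∑ γ' : HexMidEdgeSAW (Λ (s n)) (a (s n)) (b (s n)), hexCriticalFugacity ^ γ'.length)) •
            Measure.dirac (CurveClass.mk ⟨polyline (γ.verts.map fun v => ((s n : ℝ) : ℂ) *
              hexCenter v)⟩) : Measure (CurveClass ℂ)) F := by
    filter_upwards [hle] with n hn
    rwa [dcsLaw_apply hF.measurableSet]
  rw [← hr.liminf_eq]
  exact (liminf_le_liminf hle' (by isBoundedDefault) (by isBoundedDefault)).trans
    (liminf_le_limsup (by isBoundedDefault) (by isBoundedDefault))

/-- **Open-set transfer**: if `P_n(G) ≤ r_n` eventually for an open `G` with `r_n → r₀`, then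
`μ G ≤ r₀`. [cite: BillingsleyCPM1999, Thm. 2.1 (portmanteau, open sets)] -/
theorem measure_le_of_isOpen_of_ratio [IsProbabilityMeasure μ]
    (hne : ∀ᶠ n in atTop, Nonempty (HexMidEdgeSAW (Λ (s n)) (a (s n)) (b (s n))))
    (hconv : ∀ f : CurveClass ℂ →ᵇ ℝ,
      Tendsto (fun n =>
        (∑ γ : HexMidEdgeSAW (Λ (s n)) (a (s n)) (b (s n)),
            hexCriticalFugacity ^ γ.length *
              f (CurveClass.mk ⟨polyline (γ.verts.map fun v => ((s n : ℝ) : ℂ) * hexCenter v)⟩)) /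
          (∑ γ : HexMidEdgeSAW (Λ (s n)) (a (s n)) (b (s n)), hexCriticalFugacity ^ γ.length))
        atTop (𝓝 (∫ x, f x ∂μ)))
    {G : Set (CurveClass ℂ)} (hG : IsOpen G) {r : ℕ → ℝ≥0∞} {r₀ : ℝ≥0∞}
    (hr : Tendsto r atTop (𝓝 r₀))
    (hle : ∀ᶠ n in atTop, ENNReal.ofReal
      ((∑ γ : HexMidEdgeSAW (Λ (s n)) (a (s n)) (b (s n)),
          if CurveClass.mk ⟨polyline (γ.verts.map fun v => ((s n : ℝ) : ℂ) * hexCenter v)⟩ ∈ G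
          then hexCriticalFugacity ^ γ.length else 0) /
        ∑ γ : HexMidEdgeSAW (Λ (s n)) (a (s n)) (b (s n)), hexCriticalFugacity ^ γ.length) ≤ r n) :
    μ G ≤ r₀ := by
  refine ((portmanteau_of_ratio hne hconv).2 G hG).trans ?_
  have hle' : ∀ᶠ n in atTop, (∑ γ : HexMidEdgeSAW (Λ (s n)) (a (s n)) (b (s n)), ENNReal.ofReal (hexCriticalFugacity ^ γ.length /
            (∑ γ' : HexMidEdgeSAW (Λ (s n)) (a (s n)) (b (s n)), hexCriticalFugacity ^ γ'.length)) •
            Measure.dirac (CurveClass.mk ⟨polyline (γ.verts.map fun v => ((s n : ℝ) : ℂ) *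
              hexCenter v)⟩) : Measure (CurveClass ℂ)) G ≤ r n := by
    filter_upwards [hle] with n hn
    rwa [dcsLaw_apply hG.measurableSet]
  rw [← hr.liminf_eq]
  exact liminf_le_liminf hle' (by isBoundedDefault) (by isBoundedDefault)

/-- **Sure closed events pass to the limit**: if `F` is closed and eventually every walk's curve
lies in `F`, then `μ`-a.e. class lies in `F`. [cite: BillingsleyCPM1999, Thm. 2.1 (portmanteau, closed sets)] -/
theorem ae_mem_of_isClosed_of_ratio [IsProbabilityMeasure μ]
    (hne : ∀ᶠ n in atTop, Nonempty (HexMidEdgeSAW (Λ (s n)) (a (s n)) (b (s n))))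
    (hconv : ∀ f : CurveClass ℂ →ᵇ ℝ,
      Tendsto (fun n =>
        (∑ γ : HexMidEdgeSAW (Λ (s n)) (a (s n)) (b (s n)),
            hexCriticalFugacity ^ γ.length *
              f (CurveClass.mk ⟨polyline (γ.verts.map fun v => ((s n : ℝ) : ℂ) * hexCenter v)⟩)) /
          (∑ γ : HexMidEdgeSAW (Λ (s n)) (a (s n)) (b (s n)), hexCriticalFugacity ^ γ.length))
        atTop (𝓝 (∫ x, f x ∂μ)))
    {F : Set (CurveClass ℂ)} (hF : IsClosed F)
    (h : ∀ᶠ n in atTop, ∀ γ : HexMidEdgeSAW (Λ (s n)) (a (s n)) (b (s n)),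
      CurveClass.mk ⟨polyline (γ.verts.map fun v => ((s n : ℝ) : ℂ) * hexCenter v)⟩ ∈ F) :
    ∀ᵐ c ∂μ, c ∈ F := by
  have h1 : 1 ≤ μ F := by
    refine le_measure_of_isClosed_of_ratio hne hconv hF ?_
    filter_upwards [h, hne] with n hn hn'
    have : (∑ γ : HexMidEdgeSAW (Λ (s n)) (a (s n)) (b (s n)),
        if CurveClass.mk ⟨polyline (γ.verts.map fun v => ((s n : ℝ) : ℂ) * hexCenter v)⟩ ∈ F
        then hexCriticalFugacity ^ γ.length else 0) =
        ∑ γ : HexMidEdgeSAW (Λ (s n)) (a (s n)) (b (s n)), hexCriticalFugacity ^ γ.length :=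
      Finset.sum_congr rfl fun γ _ => if_pos (hn γ)
    rw [this, div_self (dcsMass_pos hn').ne', ENNReal.ofReal_one]
  have h2 : μ F = 1 := le_antisymm prob_le_one h1
  rw [ae_iff]
  change μ Fᶜ = 0
  rwa [prob_compl_eq_zero_iff hF.measurableSet]

end Portmanteau

/-! ### Registry form -/

/-- **Registered sub-goal `stub_twoPieceAdmIdentification_law`** (crux item stmt-CriticalPhenomena-14005, line
`bridge-gate-renewal`, stub `stub_twoPieceAdmIdentification`): registry form of `ae_mem_of_isClosed_of_ratio` — sure closed events of the DCS curves pass to a ratio (weak) limit. [cite: BillingsleyCPM1999, Thm. 2.1 (portmanteau, closed sets)] -/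
theorem stub_twoPieceAdmIdentification_law :
    ∀ (Λ : ℝ → Finset HexVertex) (a b : ℝ → Sym2 HexVertex) (s : ℕ → ℝ)
      (μ : Measure (CurveClass ℂ)), IsProbabilityMeasure μ →
      (∀ᶠ n in atTop, Nonempty (HexMidEdgeSAW (Λ (s n)) (a (s n)) (b (s n)))) →
      (∀ f : CurveClass ℂ →ᵇ ℝ,
        Tendsto (fun n =>
          (∑ γ : HexMidEdgeSAW (Λ (s n)) (a (s n)) (b (s n)),
              hexCriticalFugacity ^ γ.length *
                f (CurveClass.mk ⟨polyline (γ.verts.map fun v => ((s n : ℝ) : ℂ) * hexCenter v)⟩)) /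
            (∑ γ : HexMidEdgeSAW (Λ (s n)) (a (s n)) (b (s n)), hexCriticalFugacity ^ γ.length))
          atTop (𝓝 (∫ x, f x ∂μ))) →
      ∀ (F : Set (CurveClass ℂ)), IsClosed F →
      (∀ᶠ n in atTop, ∀ γ : HexMidEdgeSAW (Λ (s n)) (a (s n)) (b (s n)),
        CurveClass.mk ⟨polyline (γ.verts.map fun v => ((s n : ℝ) : ℂ) * hexCenter v)⟩ ∈ F) →
      ∀ᵐ c ∂μ, c ∈ F :=
  fun Λ a b s μ hμ hne hconv F hF h => by
    haveI := hμ
    exact ae_mem_of_isClosed_of_ratio hne hconv hF h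

end Summit.CriticalPhenomena.SAWScalingLimit.Theorems.ObservableToSLER.TwoPiece

end
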